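import Summits.MatrixMultiplication.OmegaCensus.SmallFormats.MatMul22nRankGF3ThirtySixElevenths
import HarnessLib

/-!
# ω-census family (a): the X-marginal counts of a hypothetical 23-term 𝔽₃-scheme for ⟨2,2,7⟩

Cell `pub-omega` (unit `pub-omega-tensor-g21`), topic `Summits/MatrixMultiplication/OmegaCensus`
(sub-folder `SmallFormats`). Framing (verbatim): lottery ticket; floor = certified bounds/negative ranges.
HONEST FRAMING: bookkeeping toward the kernel route for the cell's engine result 'no 23-term 𝔽₃-scheme for
⟨2,2,7⟩' (tensor-g20 engine E1/E1g, tensor-g21 engine E2; NOT a kernel theorem). This file only makes the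
(J)+(L) cap COUNTING of `MatMul22nRankGF3ThirtySixElevenths` available as explicit linear inequalities in the
numbers `z / a / b` of zero / rank-one / invertible X-coefficient matrices of an arbitrary decomposition, and
reads off the kernel-grade part of the residue classification at `(n, r) = (7, 23)`: `z = 0`, `14 ≤ a ≤ 16`,
`7 ≤ b ≤ 9` — the three windows `(a,b) ∈ {(16,7), (15,8), (14,9)}` inside which the engines' six marginal orbits
live (the finer cap system excludes `(14,9)`; that step is engine-side). Nothing here is progress on `ω`.
-/

namespace Summit.MatrixMultiplication.OmegaCensus.SmallFormats

open Module Matrix Literature.Computability.AlgebraicComplexity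
open Summit.MatrixMultiplication.OmegaCensus.RankOnePlaneCapGeneral

/-- **The (J)+(L) counting inequalities over `𝔽₃`** for any decomposition of `⟨2,2,n⟩` into `r` triads, in terms of
`z / a / b` = the numbers of zero / rank-one / invertible X-coefficient matrices:
`96n + 32z + 2a + 4b ≤ 32r` (32 dual-type plane caps, summed), `24n + 4z + a ≤ 8r` (4 quantitative row-plane caps,
summed) and `z + a + b = r`, and `4z + a ≤ Σ_d #(row plane d)`. (The proof is the body of `thirtysix_mul_le_eleven_mul_card`, stopped before `omega`.) -/
theorem xMarginal_counting_gf3 (n r : ℕ) (w : Fin r → Fin 2 × Fin n → ZMod 3)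
    (u : Fin r → Fin 2 × Fin 2 → ZMod 3) (v : Fin r → Fin 2 × Fin n → ZMod 3)
    (hdec : matMulTensor (ZMod 3) 2 2 n = ∑ i, triad (w i) (u i) (v i)) :
    96 * n + 32 * (Finset.univ.filter (fun t : Fin r => isZero43 (u t) = true)).card
        + 2 * (Finset.univ.filter (fun t : Fin r => isZero43 (u t) = false ∧ det03 (u t) = true)).card
        + 4 * (Finset.univ.filter (fun t : Fin r => isZero43 (u t) = false ∧ det03 (u t) = false)).card ≤ 32 * r ∧
      24 * n + 4 * (Finset.univ.filter (fun t : Fin r => isZero43 (u t) = true)).card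
        + (Finset.univ.filter (fun t : Fin r => isZero43 (u t) = false ∧ det03 (u t) = true)).card ≤ 8 * r ∧
      (Finset.univ.filter (fun t : Fin r => isZero43 (u t) = true)).card
        + (Finset.univ.filter (fun t : Fin r => isZero43 (u t) = false ∧ det03 (u t) = true)).card
        + (Finset.univ.filter (fun t : Fin r => isZero43 (u t) = false ∧ det03 (u t) = false)).card = r ∧
      4 * (Finset.univ.filter (fun t : Fin r => isZero43 (u t) = true)).card
        + (Finset.univ.filter (fun t : Fin r => isZero43 (u t) = false ∧ det03 (u t) = true)).card
        ≤ ∑ d : Fin 4, (Finset.univ.filter fun t => rowVan (u t) d = true).card := by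
  classical
  have hA : ∀ i x, (bilinCompOfTriads (ZMod 3) w u v hdec).f i x = dotX (u i) x := fun i x => rfl
  -- (J) the cap of each of the 32 dual-type planes, summed
  have hJ : ∀ l : Fin 32, 3 * n + (Finset.univ.filter fun i => perp3 (u i) l = true).card ≤ r := by
    intro l
    have h := (jPlane3 l).three_mul_add_card_le (bilinCompOfTriads (ZMod 3) w u v hdec) u hA
      (fun i => perp3 (u i) l = true) (fun i hi => perp3_dotX hi)
    simpa only [Fintype.card_fin] using h
  have hJsum : ∑ l : Fin 32, (3 * n + (Finset.univ.filter fun i => perp3 (u i) l = true).card)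
      ≤ ∑ _l : Fin 32, r := Finset.sum_le_sum fun l _ => hJ l
  rw [Finset.sum_add_distrib] at hJsum
  simp only [Finset.sum_const, Finset.card_univ, Fintype.card_fin, smul_eq_mul] at hJsum
  have hI : ∑ i, (32 * (if isZero43 (u i) = true then 1 else 0)
      + 2 * (if (isZero43 (u i) = false ∧ det03 (u i) = true) then 1 else 0)
      + 4 * (if (isZero43 (u i) = false ∧ det03 (u i) = false) then 1 else 0))
      ≤ ∑ l : Fin 32, (Finset.univ.filter fun i => perp3 (u i) l = true).card := by
    calc _ ≤ ∑ i, (Finset.univ.filter fun l => perp3 (u i) l = true).card :=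
          Finset.sum_le_sum fun i _ => inc3_le_card_perp3 (u i)
      _ = ∑ l : Fin 32, (Finset.univ.filter fun i => perp3 (u i) l = true).card := by
          simp only [Finset.card_filter]
          exact Finset.sum_comm
  -- (L) the quantitative cap of each of the 4 row planes, summed
  have hRow : ∀ d : Fin 4, (Finset.univ.filter fun t => rowVan (u t) d = true).card + 6 * n ≤ 2 * r := by
    intro d
    have h := card_vanishing_le_two_mul_sub (n := n) (le_refl 2) (bilinCompOfTriads (ZMod 3) w u v hdec)
      (lam3_ne_zero d) (Finset.univ.filter fun t => rowVan (u t) d = true)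
      (fun i hi z => by
        rw [Finset.mem_filter] at hi
        rw [hA]
        exact dotX_vecMulVec_row hi.2 z)
    simpa only [Fintype.card_fin] using h
  have hRsum : ∑ d : Fin 4, ((Finset.univ.filter fun t => rowVan (u t) d = true).card + 6 * n)
      ≤ ∑ _d : Fin 4, 2 * r := Finset.sum_le_sum fun d _ => hRow d
  rw [Finset.sum_add_distrib] at hRsum
  simp only [Finset.sum_const, Finset.card_univ, Fintype.card_fin, smul_eq_mul] at hRsum
  have hL : ∑ i, (4 * (if isZero43 (u i) = true then 1 else 0)
      + (if (isZero43 (u i) = false ∧ det03 (u i) = true) then 1 else 0))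
      ≤ ∑ d : Fin 4, (Finset.univ.filter fun t => rowVan (u t) d = true).card := by
    calc _ ≤ ∑ i, (Finset.univ.filter fun d => rowVan (u i) d = true).card :=
          Finset.sum_le_sum fun i _ => rinc3_le_card_rowVan (u i)
      _ = ∑ d : Fin 4, (Finset.univ.filter fun t => rowVan (u t) d = true).card := by
          simp only [Finset.card_filter]
          exact Finset.sum_comm
  -- bookkeeping: z / a / b
  set Z0 := Finset.univ.filter (fun t : Fin r => isZero43 (u t) = true) with hZ0
  set R1 := Finset.univ.filter (fun t : Fin r => isZero43 (u t) = false ∧ det03 (u t) = true) with hR1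
  set T2 := Finset.univ.filter (fun t : Fin r => isZero43 (u t) = false ∧ det03 (u t) = false) with hT2
  have hpart : ∀ A : Fin 2 × Fin 2 → ZMod 3, (if isZero43 A = true then 1 else 0)
      + (if (isZero43 A = false ∧ det03 A = true) then 1 else 0)
      + (if (isZero43 A = false ∧ det03 A = false) then 1 else 0) = 1 := by
    intro A
    by_cases h0 : isZero43 A = true <;> by_cases h1 : det03 A = true <;> simp [h0, h1]
  have hpsum := Finset.sum_congr rfl fun i (_ : i ∈ (Finset.univ : Finset (Fin r))) => hpart (u i)
  rw [Finset.sum_add_distrib, Finset.sum_add_distrib, Finset.sum_boole, Finset.sum_boole, Finset.sum_boole] at hpsum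
  simp only [Finset.sum_const, Finset.card_univ, Fintype.card_fin, smul_eq_mul, mul_one, Nat.cast_id] at hpsum
  rw [Finset.sum_add_distrib, Finset.sum_add_distrib, ← Finset.mul_sum, ← Finset.mul_sum, ← Finset.mul_sum,
    Finset.sum_boole, Finset.sum_boole, Finset.sum_boole] at hI
  simp only [Nat.cast_id] at hI
  rw [Finset.sum_add_distrib, ← Finset.mul_sum, Finset.sum_boole, Finset.sum_boole] at hL
  simp only [Nat.cast_id] at hL
  rw [← hZ0, ← hR1, ← hT2] at hpsum hI
  rw [← hZ0, ← hR1] at hL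
  exact ⟨by omega, by omega, by omega, hL⟩

/-- **Residue windows at `(n, r) = (7, 23)` over `𝔽₃`**: any decomposition of `⟨2,2,7⟩` into `23` triads has NO zero
X-coefficient matrix, between `14` and `16` rank-one ones and between `7` and `9` invertible ones. (The cell's two engines
then exclude all six cap-feasible marginal orbits inside these windows; that exclusion is NOT a kernel statement.) -/
theorem xMarginal_windows_227_gf3 (w : Fin 23 → Fin 2 × Fin 7 → ZMod 3)
    (u : Fin 23 → Fin 2 × Fin 2 → ZMod 3) (v : Fin 23 → Fin 2 × Fin 7 → ZMod 3)
    (hdec : matMulTensor (ZMod 3) 2 2 7 = ∑ i, triad (w i) (u i) (v i)) :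
    (Finset.univ.filter (fun t : Fin 23 => isZero43 (u t) = true)).card = 0 ∧
      14 ≤ (Finset.univ.filter (fun t : Fin 23 => isZero43 (u t) = false ∧ det03 (u t) = true)).card ∧
      (Finset.univ.filter (fun t : Fin 23 => isZero43 (u t) = false ∧ det03 (u t) = true)).card ≤ 16 ∧
      7 ≤ (Finset.univ.filter (fun t : Fin 23 => isZero43 (u t) = false ∧ det03 (u t) = false)).card ∧
      (Finset.univ.filter (fun t : Fin 23 => isZero43 (u t) = false ∧ det03 (u t) = false)).card ≤ 9 := by
  obtain ⟨h1, h2, h3, -⟩ := xMarginal_counting_gf3 7 23 w u v hdec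
  exact ⟨by omega, by omega, by omega, by omega, by omega⟩

/-- In particular every X-coefficient matrix of a 23-term decomposition of `⟨2,2,7⟩` over `𝔽₃` is nonzero. -/
theorem xform_ne_zero_227_gf3 (w : Fin 23 → Fin 2 × Fin 7 → ZMod 3)
    (u : Fin 23 → Fin 2 × Fin 2 → ZMod 3) (v : Fin 23 → Fin 2 × Fin 7 → ZMod 3)
    (hdec : matMulTensor (ZMod 3) 2 2 7 = ∑ i, triad (w i) (u i) (v i)) (t : Fin 23) : isZero43 (u t) = false := by
  have h := (xMarginal_windows_227_gf3 w u v hdec).1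
  rw [Finset.card_eq_zero, Finset.filter_eq_empty_iff] at h
  have ht := h (Finset.mem_univ t)
  cases hb : isZero43 (u t)
  · rfl
  · exact absurd hb ht

/-- (J) as a per-plane statement: each of the 32 dual-type planes of X-forms (encoding `perp3` of
`MatMul22nRankGF3LowerBound`) is annihilated by at most `r − 3n` of the X-forms of any decomposition of `⟨2,2,n⟩` over `𝔽₃`
into `r` triads — the plane cap used by both engines' marginal censuses, in kernel form. -/
theorem dualPlane_cap_gf3 (n r : ℕ) (w : Fin r → Fin 2 × Fin n → ZMod 3)
    (u : Fin r → Fin 2 × Fin 2 → ZMod 3) (v : Fin r → Fin 2 × Fin n → ZMod 3)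
    (hdec : matMulTensor (ZMod 3) 2 2 n = ∑ i, triad (w i) (u i) (v i)) (l : Fin 32) :
    3 * n + (Finset.univ.filter fun i => perp3 (u i) l = true).card ≤ r := by
  classical
  have hA : ∀ i x, (bilinCompOfTriads (ZMod 3) w u v hdec).f i x = dotX (u i) x := fun i x => rfl
  have h := (jPlane3 l).three_mul_add_card_le (bilinCompOfTriads (ZMod 3) w u v hdec) u hA
    (fun i => perp3 (u i) l = true) (fun i hi => perp3_dotX hi)
  simpa only [Fintype.card_fin] using h

/-- (L) as a per-plane statement: each of the 4 row planes `{λ zᵀ}` (encoding `rowVan` of `MatMul223RankGF3Cert`)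
carries at most `2r − 6n` of the X-forms (lit's quantitative rank-one-plane cap), in kernel form. -/
theorem rowPlane_cap_gf3 (n r : ℕ) (w : Fin r → Fin 2 × Fin n → ZMod 3)
    (u : Fin r → Fin 2 × Fin 2 → ZMod 3) (v : Fin r → Fin 2 × Fin n → ZMod 3)
    (hdec : matMulTensor (ZMod 3) 2 2 n = ∑ i, triad (w i) (u i) (v i)) (d : Fin 4) :
    (Finset.univ.filter fun t => rowVan (u t) d = true).card + 6 * n ≤ 2 * r := by
  classical
  have hA : ∀ i x, (bilinCompOfTriads (ZMod 3) w u v hdec).f i x = dotX (u i) x := fun i x => rfl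
  have h := card_vanishing_le_two_mul_sub (n := n) (le_refl 2) (bilinCompOfTriads (ZMod 3) w u v hdec)
    (lam3_ne_zero d) (Finset.univ.filter fun t => rowVan (u t) d = true)
    (fun i hi z => by
      rw [Finset.mem_filter] at hi
      rw [hA]
      exact dotX_vecMulVec_row hi.2 z)
  simpa only [Fintype.card_fin] using h

/-- **The saturated-row regime is forced at `(7,23)`**: in any decomposition of `⟨2,2,7⟩` over `𝔽₃` into 23 triads at least
TWO of the four row planes `{λ zᵀ}` are SATURATED, i.e. carry exactly `4 = 2r − 6n` X-forms (each carries ≤ 4 by the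
quantitative cap, and together they carry all `a ≥ 14` rank-one forms). This is the structural entry point of both engines
(the saturated-row law pins `G_t ∈ k² ⊗ F_θ`); the engines' marginal census sharpens 'at least two' to 'three or four'. -/
theorem two_le_card_saturatedRows_227_gf3 (w : Fin 23 → Fin 2 × Fin 7 → ZMod 3)
    (u : Fin 23 → Fin 2 × Fin 2 → ZMod 3) (v : Fin 23 → Fin 2 × Fin 7 → ZMod 3)
    (hdec : matMulTensor (ZMod 3) 2 2 7 = ∑ i, triad (w i) (u i) (v i)) :
    2 ≤ (Finset.univ.filter fun d : Fin 4 =>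
      (Finset.univ.filter fun t : Fin 23 => rowVan (u t) d = true).card = 4).card := by
  classical
  obtain ⟨h1, h2, h3, h4⟩ := xMarginal_counting_gf3 7 23 w u v hdec
  have hs : 14 ≤ ∑ d : Fin 4, (Finset.univ.filter fun t : Fin 23 => rowVan (u t) d = true).card := by omega
  rw [Fin.sum_univ_four] at hs
  have hc0 := rowPlane_cap_gf3 7 23 w u v hdec 0
  have hc1 := rowPlane_cap_gf3 7 23 w u v hdec 1
  have hc2 := rowPlane_cap_gf3 7 23 w u v hdec 2
  have hc3 := rowPlane_cap_gf3 7 23 w u v hdec 3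
  rw [Finset.card_filter, Fin.sum_univ_four]
  split_ifs <;> omega

end Summit.MatrixMultiplication.OmegaCensus.SmallFormats
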